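import Literature.Barriers.NavierStokesRegularity.PalasekTowerKelvinCeiling
import HarnessLib

/-!
# Barrier supplement: the Kelvin ceiling is RATE-FREE (`PalasekTowerKelvinCeiling.of_not_bddAbove`)

Supplement to the catalogue entry `Literature.Barriers.NavierStokesRegularity.PalasekTowerKelvinCeiling`
(D-0021; negative side of `NavierStokesRegularity`). HONEST FRAMING (cell `pub/ns-blowup`, D-0035):
nothing here is a claim about blow-up or regularity of the Navier–Stokes equations. WHAT THIS IS NOT:
not NS evidence — a conditional no-go for winding-one vorticity towers, with every hypothesis explicit.

## What and why

The entry is typed with a POWER floor (H-core) `c · N_k^{β-2} ≤ Γ_k`, `β > 2`, `c > 0`, `N_k → ∞`,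
after Palasek's dictionary `A_k = N_k^β`, core radius `N_k^{-1}`, `Γ_k ≍ N_k^{β-2}`
[cite: Palasek2026ElementaryModel, §3.1 (3.1)–(3.2)]. A reading proposed in the cell ("drifting
exponents" `β_k → 2`, `b_k → 1` with `(β_k - 2)·log N_k ≍ log log N_k → ∞`, so that `Γ_k` grows only
like a power of `log N_k` — the "polylog corner") suggested that the ceiling then "stops biting". It
does not: in the entry the frequencies `N_k`, the exponent `β` and the constant `c` are DUMMIES — given
ANY tower whose level circulations are unbounded above, `N_k := Γ_k`, `β := 3`, `c := 1` satisfy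
(H-core) — and the engine of the proof is the budgeted Kelvin recursion `Γ_{k+1} ≤ Γ_k + B_k`
[cite: MajdaBertozziCUP2002, §1.6 Prop. 1.11 eqs. (1.59)–(1.61)], which bounds `Γ_k ≤ Γ_0 + M` and
therefore excludes EVERY unbounded sequence of level circulations, at any rate and along any
subsequence. This file records that rate-free form and its named special cases:

* `PalasekTowerKelvinCeiling.circulation_le_of_tower` — the positive content: under (H-single) and
  (H-budget) with `∑_{k<n} B_k ≤ M`, every level has `Γ_n ≤ Γ_0 + M`;
* `PalasekTowerKelvinCeiling.of_not_bddAbove` — no winding-one, budget-bounded tower has level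
  circulations unbounded above (the sharp form: (H-core) replaced by `¬ BddAbove (range Γ)`);
* `PalasekTowerKelvinCeiling.of_tendsto` — in particular none with `Γ_k → +∞`, derived from the ENTRY
  ITSELF by the dummy instantiation `N := Γ, β := 3, c := 1` (documenting that the letter of the entry
  already covers it); `PalasekTowerKelvinCeiling.euler_of_tendsto` likewise for smooth Euler flows;
* `PalasekTowerKelvinCeiling.of_polylog_floor` — the polylog corner by name: a floor
  `c · (log N_k)^s ≤ Γ_k` with `s > 0`, `c > 0`, `N_k → ∞` is excluded exactly like the power floor.

Consequently evasion (2) of the entry ("`β ≤ 2`") sharpens to: the level circulations stay BOUNDED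
ABOVE — in the dictionary `A_k ≤ C · N_k²` for one constant `C`, i.e. `(β_k - 2)·log N_k = O(1)`, the
Kelvin-neutral / Type-I line up to a constant factor; every drifting schedule with
`(β_k - 2)·log N_k → ∞` is inside the barrier. The other evasions ((1) bundling/winding `m_k > 1`,
(3) unbounded viscous/force budget, (4) Kelvin-free models, (5) non-patch structures) are unchanged;
what the polylog corner DOES buy is on the side of evasion (1): the multiplicity a bundling design must
supply per level, `m_k = Γ_{k+1}/Γ_k`, tends to `1` instead of growing like `N_k^{(b-1)(β-2)}` — a
bounded folding burden per level, which is a statement about designs violating (H-single), not about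
the ceiling.

References: A. J. Majda, A. L. Bertozzi, *Vorticity and Incompressible Flow* (CUP 2002), §1.6
Prop. 1.11, (1.59)–(1.61) [cite: MajdaBertozziCUP2002, §1.6 Prop. 1.11 eqs. (1.59)–(1.61)];
S. Palasek, arXiv:2605.13827, §3.1 (3.1)–(3.2), Thm. 1.3, Rem. 1.5
[cite: Palasek2026ElementaryModel, §3.1 (3.2) and Thm. 1.3]; A. J. Chorin, *Vorticity and Turbulence*
(Springer 1994), §5.1–§5.2 [cite: Chorin1994VorticityTurbulence, §5.1–§5.2 (PDF pp. 85–87)].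
-/

noncomputable section

open MeasureTheory Set Filter intervalIntegral Real
open _root_.Topology
open scoped InnerProductSpace RealInnerProductSpace
open Literature.Analysis.FluidPDE

namespace Literature.Barriers.NavierStokesRegularity

section Forced

variable {E : Type*} [NormedAddCommGroup E] [InnerProductSpace ℝ E] [FiniteDimensional ℝ E]
variable {S : Set ℝ} {ν : ℝ} {f u : ℝ → E → E} {p : ℝ → E → ℝ} {X : ℝ → E → E}

open scoped Laplacian

/-- **The budgeted Kelvin recursion summed up the tower** (the positive content of the entry). For a
classical solution of `∂ₜu + (u·∇)u = νΔu − ∇p + f`, `div u = 0` on `E × S` (`S` convex, any `ν`,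
any `f`), a jointly smooth trajectory map `X` with `∂ₜX = u(t,X)` within `S`, level times
`t_0 < t_1 < …` in `S`, closed `C¹` label loops `γ_k`: if for every `k` the material pre-image at
time `t_k` of level `k+1`'s core loop has circulation at most level `k`'s (H-single) and the episode's
viscous + force circulation input along it is `≤ B_k` (H-budget) with `∑_{k<n} B_k ≤ M`, then
`Γ_n ≤ Γ_0 + M` for every `n`, `Γ_k := ∮_{X(t_k)∘γ_k} u(t_k)·dℓ`. Kelvin's theorem with viscosity
and force (Majda–Bertozzi (1.61)), tree `IsClassicalNSSolutionOn.circulation_sub_eq_integral` via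
`PalasekTower.circulation_le_of_preimage_le_forced`. [cite: MajdaBertozziCUP2002, §1.6 Prop. 1.11 eq. (1.61)] -/
theorem PalasekTowerKelvinCeiling.circulation_le_of_tower (h : IsClassicalNSSolutionOn S ν f u p)
    (hS : Convex ℝ S) (hX : IsSmoothSpaceTimeOn S X)
    (hXu : ∀ t ∈ S, ∀ a, HasDerivWithinAt (fun s => X s a) (u t (X t a)) S t)
    {t : ℕ → ℝ} {γ : ℕ → ℝ → E} {B : ℕ → ℝ} {M : ℝ}
    (ht : ∀ k, t k ∈ S) (hlt : ∀ k, t k < t (k + 1)) (hγ : ∀ k, ContDiff ℝ 1 (γ k))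
    (hloop : ∀ k, γ k 0 = γ k 1)
    (hsingle : ∀ k, circulation (u (t k)) (X (t k) ∘ γ (k + 1)) ≤
      circulation (u (t k)) (X (t k) ∘ γ k))
    (hB : ∀ k, ∫ s in t k..t (k + 1),
      circulation (fun x => ν • Δ (u s) x + f s x) (X s ∘ γ (k + 1)) ≤ B k)
    (hM : ∀ n, ∑ k ∈ Finset.range n, B k ≤ M) (n : ℕ) :
    circulation (u (t n)) (X (t n) ∘ γ n) ≤ circulation (u (t 0)) (X (t 0) ∘ γ 0) + M := by
  have hstep : ∀ k, circulation (u (t (k + 1))) (X (t (k + 1)) ∘ γ (k + 1)) ≤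
      circulation (u (t k)) (X (t k) ∘ γ k) + B k := by
    intro k
    have hsub : Icc (t k) (t (k + 1)) ⊆ S := hS.ordConnected.out (ht k) (ht (k + 1))
    have hk : IsClassicalNSSolutionOn (Icc (t k) (t (k + 1))) ν f u p :=
      h.mono hsub (uniqueDiffOn_Icc (hlt k))
    exact PalasekTower.circulation_le_of_preimage_le_forced (hlt k) hk (hX.mono hsub)
      (fun s hs y => (hXu s (hsub hs) y).mono hsub) (hγ (k + 1)) (hloop (k + 1))
      (hsingle k) (hB k)
  have hsum : ∀ m, circulation (u (t m)) (X (t m) ∘ γ m) ≤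
      circulation (u (t 0)) (X (t 0) ∘ γ 0) + ∑ k ∈ Finset.range m, B k := by
    intro m
    induction m with
    | zero => simp
    | succ m ih =>
      rw [Finset.sum_range_succ]
      linarith [hstep m]
  linarith [hsum n, hM n]

/-- **Barrier, rate-free form: no winding-one, budget-bounded vorticity tower with UNBOUNDED level
circulations** — the sharp form of `PalasekTowerKelvinCeiling`, (H-core) `c N_k^{β-2} ≤ Γ_k` replaced
by `¬ BddAbove (range Γ)`: the level circulations may grow at any rate and along any subsequence.
Same data and the same hypotheses (H-single), (H-budget) as the entry; proof:
`circulation_le_of_tower` gives `Γ_n ≤ Γ_0 + M`. Not in print as a statement — Kelvin's theorem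
(Majda–Bertozzi (1.59)–(1.61)) read up a tower.

BARRIER (structured block, D-0021):
- technique_class: blowup-construction vorticity-tower super-lacunary-shell-embedding obukhov-palasek-literal-embedding fixed-level-single-structure-cascade winding-one-vortex-stretching discrete-self-similar-vortex-cascade fluid-computer-vortex-gates drifting-exponent-tower polylog-type-II-tower
- blocks: for NavierStokesRegularity (negative side, by construction) the same scenarios as the entry `PalasekTowerKelvinCeiling`, WITHOUT any rate hypothesis on the level circulations: an infinite sequence of vortex structures inside the smooth lifetime, structure `k+1` carved out of material whose loop at time `t_k` winds once around ONE co-signed structure `k` (H-single), cumulative viscous + force circulation input bounded (H-budget), and circulation per structure unbounded above — in particular every "drifting exponent" schedule of Palasek's dictionary (`A_k = N_k^{β_k}`, `Γ_k ≍ N_k^{β_k-2}`) with `(β_k - 2)·log N_k → ∞`, such as the polylog corner `Γ_k ≍ (log N_k)^s`, `s > 0` (`of_polylog_floor`) [cite: Palasek2026ElementaryModel, §3.1 (3.1)–(3.2) and Rem. 1.5].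
- because: the budgeted Kelvin identity gives `Γ_{k+1} ≤ Γ_k + B_k` [cite: MajdaBertozziCUP2002, §1.6 Prop. 1.11 eq. (1.61)], hence `Γ_n ≤ Γ_0 + M` for all `n` (`circulation_le_of_tower`): the level circulations of a winding-one budget-bounded tower are bounded above, full stop; the entry's `N_k`, `β`, `c` are dummies (`of_tendsto` instantiates `N := Γ`, `β := 3`, `c := 1`).
- evasions_known: those of the entry, with (2) SHARPENED: (1) ¬(H-single), bundling / winding number `m_k = Γ_{k+1}/Γ_k > 1` [cite: Chorin1994VorticityTurbulence, §5.2–§5.3 (PDF pp. 86–87, 92)] — and here the polylog corner genuinely helps the DESIGNER, since `m_k → 1` (bounded folding burden per level) instead of `m_k ≍ N_k^{(b-1)(β-2)} → ∞`; (2♯) level circulations BOUNDED ABOVE: in the dictionary `A_k ≤ C·N_k²` for one constant `C`, i.e. `(β_k - 2)·log N_k = O(1)` — the Kelvin-neutral / Type-I line up to a constant (Euler towers with `β ≤ 2`; Palasek's inviscid admissible set) [cite: Palasek2026ElementaryModel, §3.1 (3.1) and Thm. 1.8]; (3) ¬(H-budget), reconnection / merger or an `O(1)` force as circulation source [cite: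 Chorin1994VorticityTurbulence, §5.2 (PDF p. 87)]; (4) Kelvin-free model systems [cite: Tao2016AveragedNS, §1.3 (arXiv p. 11) and Rem. 4.3]; (5) non-patch structures outside (H-single)/(H-core) as typed.
- scope_caveats: exactly those of the entry (classical solutions on a convex smooth lifetime `S`, trajectory map supplied, any finite-dimensional `E`, any `ν`, any `f`; (H-single)/(H-budget) are circulation statements whose geometric reading is the invoker's modelling step; nothing here is a regularity criterion) [cite: MajdaBertozziCUP2002, §1.6 Prop. 1.11 and §1.3 eq. (1.13)]; NOT IN PRINT as stated — a theorem of this tree.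
- status: established — machine-checked here (std axioms). -/
theorem PalasekTowerKelvinCeiling.of_not_bddAbove (h : IsClassicalNSSolutionOn S ν f u p)
    (hS : Convex ℝ S) (hX : IsSmoothSpaceTimeOn S X)
    (hXu : ∀ t ∈ S, ∀ a, HasDerivWithinAt (fun s => X s a) (u t (X t a)) S t) {M : ℝ} :
    ¬ ∃ (t : ℕ → ℝ) (γ : ℕ → ℝ → E) (B : ℕ → ℝ),
      (∀ k, t k ∈ S) ∧ (∀ k, t k < t (k + 1)) ∧ (∀ k, ContDiff ℝ 1 (γ k)) ∧
      (∀ k, γ k 0 = γ k 1) ∧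
      ¬ BddAbove (Set.range fun k => circulation (u (t k)) (X (t k) ∘ γ k)) ∧
      (∀ k, circulation (u (t k)) (X (t k) ∘ γ (k + 1)) ≤
        circulation (u (t k)) (X (t k) ∘ γ k)) ∧
      (∀ k, ∫ s in t k..t (k + 1),
        circulation (fun x => ν • Δ (u s) x + f s x) (X s ∘ γ (k + 1)) ≤ B k) ∧
      (∀ n, ∑ k ∈ Finset.range n, B k ≤ M) := by
  rintro ⟨t, γ, B, ht, hlt, hγ, hloop, hunb, hsingle, hB, hM⟩
  refine hunb ⟨circulation (u (t 0)) (X (t 0) ∘ γ 0) + M, ?_⟩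
  rintro _ ⟨n, rfl⟩
  exact PalasekTowerKelvinCeiling.circulation_le_of_tower h hS hX hXu ht hlt hγ hloop hsingle hB hM n

/-- **No winding-one budget-bounded tower with `Γ_k → +∞`, whatever the rate** — derived from the
ENTRY `PalasekTowerKelvinCeiling` itself by the dummy instantiation `N_k := Γ_k`, `β := 3`, `c := 1`
(so the entry's letter already covers sub-power growth such as `Γ_k ≍ (log N_k)^s`).
[cite: MajdaBertozziCUP2002, §1.6 Prop. 1.11 eq. (1.61)] -/
theorem PalasekTowerKelvinCeiling.of_tendsto (h : IsClassicalNSSolutionOn S ν f u p)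
    (hS : Convex ℝ S) (hX : IsSmoothSpaceTimeOn S X)
    (hXu : ∀ t ∈ S, ∀ a, HasDerivWithinAt (fun s => X s a) (u t (X t a)) S t) {M : ℝ} :
    ¬ ∃ (t : ℕ → ℝ) (γ : ℕ → ℝ → E) (B : ℕ → ℝ),
      (∀ k, t k ∈ S) ∧ (∀ k, t k < t (k + 1)) ∧ (∀ k, ContDiff ℝ 1 (γ k)) ∧
      (∀ k, γ k 0 = γ k 1) ∧
      Tendsto (fun k => circulation (u (t k)) (X (t k) ∘ γ k)) atTop atTop ∧
      (∀ k, circulation (u (t k)) (X (t k) ∘ γ (k + 1)) ≤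
        circulation (u (t k)) (X (t k) ∘ γ k)) ∧
      (∀ k, ∫ s in t k..t (k + 1),
        circulation (fun x => ν • Δ (u s) x + f s x) (X s ∘ γ (k + 1)) ≤ B k) ∧
      (∀ n, ∑ k ∈ Finset.range n, B k ≤ M) := by
  rintro ⟨t, γ, B, ht, hlt, hγ, hloop, hΓ, hsingle, hB, hM⟩
  refine PalasekTowerKelvinCeiling h hS hX hXu (β := 3) (c := 1) (M := M) (by norm_num) one_pos
    ⟨t, γ, fun k => circulation (u (t k)) (X (t k) ∘ γ k), B, ht, hlt, hγ, hloop, hΓ, ?_,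
      hsingle, hB, hM⟩
  intro k
  norm_num

/-- **The polylog corner by name.** With a floor `c · (log N_k)^s ≤ Γ_k`, `s > 0`, `c > 0`,
`N_k → ∞` — the level circulations of a "drifting exponent" schedule `β_k - 2 ≍ log log N_k / log N_k`
of Palasek's dictionary — a winding-one budget-bounded tower is excluded exactly as with the power
floor of the entry. [cite: Palasek2026ElementaryModel, §3.1 (3.2) and Rem. 1.5] -/
theorem PalasekTowerKelvinCeiling.of_polylog_floor (h : IsClassicalNSSolutionOn S ν f u p)
    (hS : Convex ℝ S) (hX : IsSmoothSpaceTimeOn S X)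
    (hXu : ∀ t ∈ S, ∀ a, HasDerivWithinAt (fun s => X s a) (u t (X t a)) S t)
    {s c M : ℝ} (hs : 0 < s) (hc : 0 < c) :
    ¬ ∃ (t : ℕ → ℝ) (γ : ℕ → ℝ → E) (N B : ℕ → ℝ),
      (∀ k, t k ∈ S) ∧ (∀ k, t k < t (k + 1)) ∧ (∀ k, ContDiff ℝ 1 (γ k)) ∧
      (∀ k, γ k 0 = γ k 1) ∧ Tendsto N atTop atTop ∧
      (∀ k, c * (Real.log (N k)) ^ s ≤ circulation (u (t k)) (X (t k) ∘ γ k)) ∧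
      (∀ k, circulation (u (t k)) (X (t k) ∘ γ (k + 1)) ≤
        circulation (u (t k)) (X (t k) ∘ γ k)) ∧
      (∀ k, ∫ s in t k..t (k + 1),
        circulation (fun x => ν • Δ (u s) x + f s x) (X s ∘ γ (k + 1)) ≤ B k) ∧
      (∀ n, ∑ k ∈ Finset.range n, B k ≤ M) := by
  rintro ⟨t, γ, N, B, ht, hlt, hγ, hloop, hN, hcore, hsingle, hB, hM⟩
  refine PalasekTowerKelvinCeiling.of_tendsto h hS hX hXu (M := M)
    ⟨t, γ, B, ht, hlt, hγ, hloop, ?_, hsingle, hB, hM⟩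
  have hg : Tendsto (fun k => c * (Real.log (N k)) ^ s) atTop atTop :=
    Tendsto.const_mul_atTop hc ((tendsto_rpow_atTop hs).comp (tendsto_log_atTop.comp hN))
  exact tendsto_atTop_mono hcore hg

end Forced

section Euler

variable {E : Type*} [NormedAddCommGroup E] [InnerProductSpace ℝ E] [FiniteDimensional ℝ E]
variable {S : Set ℝ} {u : ℝ → E → E} {p : ℝ → E → ℝ} {X : ℝ → E → E}

/-- **Smooth Euler flows: no winding-one tower with `Γ_k → +∞`, whatever the rate** — from
`PalasekTowerKelvinCeiling.euler` by the dummy instantiation `N := Γ`, `β := 3`, `c := 1`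
(unordered level times, no budget). [cite: MajdaBertozziCUP2002, §1.6 Prop. 1.11 eq. (1.59)] -/
theorem PalasekTowerKelvinCeiling.euler_of_tendsto (h : IsClassicalEulerSolutionOn S 0 u p)
    (hS : Convex ℝ S) (hX : IsSmoothSpaceTimeOn S X)
    (hXu : ∀ t ∈ S, ∀ a, HasDerivWithinAt (fun s => X s a) (u t (X t a)) S t) :
    ¬ ∃ (t : ℕ → ℝ) (γ : ℕ → ℝ → E),
      (∀ k, t k ∈ S) ∧ (∀ k, ContDiff ℝ 1 (γ k)) ∧ (∀ k, γ k 0 = γ k 1) ∧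
      Tendsto (fun k => circulation (u (t k)) (X (t k) ∘ γ k)) atTop atTop ∧
      (∀ k, circulation (u (t k)) (X (t k) ∘ γ (k + 1)) ≤
        circulation (u (t k)) (X (t k) ∘ γ k)) := by
  rintro ⟨t, γ, ht, hγ, hloop, hΓ, hsingle⟩
  refine PalasekTowerKelvinCeiling.euler h hS hX hXu (β := 3) (c := 1) (by norm_num) one_pos
    ⟨t, γ, fun k => circulation (u (t k)) (X (t k) ∘ γ k), ht, hγ, hloop, hΓ, ?_, hsingle⟩
  intro k
  norm_num

end Euler

end Literature.Barriers.NavierStokesRegularity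

end
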